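import Mathlib.Algebra.MvPolynomial.PDeriv
import Mathlib.RingTheory.MvPolynomial.EulerIdentity
import Literature.NumberTheory.DiophantineGeometry.TensorWordModel
import Literature.Computability.AlgebraicComplexity.OrbitClosureWeights
import Literature.Computability.AlgebraicComplexity.PowerSumNonvanishing
import HarnessLib

/-!
# The inner degree lifting of BIP §5 in the coordinate-ring convention, and degree bookkeeping for
# highest-weight vectors of `k[Sym^m]`

Bürgisser–Ikenmeyer–Panova, J. AMS 32 (2019) = arXiv:1604.06431v3, §5 ("Lifting highest weight
vectors in plethysms"), §5(a)–(b): the multiplication map `M : Sym^m V → Sym^n V, p ↦ p e_1^{n-m}`,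
its dual `M^* = (m!/n!) ∂_{e_1}^{n-m}` (Lemma 5.1), the automorphism
`Δ : p ↦ M^*(X_1^{n-m} p)` of `Sym^m V^*` (Lemma 5.2), the inner degree lifting
`κ_{m,n}^d = Sym^d M : Sym^d Sym^m V → Sym^d Sym^n V` (5.3), Lemma 5.3 (`κ` maps highest-weight
vectors of weight `μ` to highest-weight vectors of weight `μ♯dn`), and Thm. 5.4
(`⟨κ(f), q^d⟩ = ⟨f, M^*(q)^d⟩`: "This allows to express the evaluation of the lifted `κ(f)` at
`q`, viewed as a polynomial function on `Sym^n V^*`, as the evaluation of `f` at `M^*(q)`").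

In G20's convention a "highest weight vector of `Sym^d Sym^n V` viewed as a degree-`d` polynomial
function on `Sym^n V^*`" is an element of `k[Sym^n] = MvPolynomial (DegIdx σ n) k` in the
highest-weight space of `coordRep σ k n` (weights are duals of partitions, the first row sits at
the greatest index `iₘ`, BIP's `e_1`/`X_1` is our `x_{iₘ}`). This file

* defines the iterated partial derivative `iterPderiv i r = ∂_i^r` (§1) and the **inner lifting**
  `innerLift i m n : k[Sym^m] →ₐ k[Sym^n]`, `F ↦ F ∘ ∂_i^{n-m}` (§3; the dual of `κ`, with BIP's
  normalising factor `m!/n!` dropped — it rescales degree-`d` functions by a nonzero constant),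
  through the general **pullback along a linear map of forms** `pullbackAlong a b T` (§2), of which
  G20's `coordSubst` is also an instance;
* PROVES Thm. 5.4 in this form (`aeval_formCoeff_innerLift`: `(innerLift F)(q) = F(∂^{n-m} q)`),
  Lemma 5.2 (`formCoeff_iterPderiv_X_pow_mul`: `∂_i^r (X_i^r p)` rescales the coefficients of `p` by
  the positive integers `(e_i+r)!/e_i!`; `aeval_formCoeff_iterPderiv_X_pow_mul`,
  `support_aeval_C_mul_X`: the change of coordinates `F ↦ F ∘ Δ`), and Lemma 5.3
  (`coordSubst_innerLift`, `innerLift_mem_highestWeightSpace`: `innerLift` maps highest-weight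
  vectors of weight `χ` and degree `D` to highest-weight vectors of weight `χ - (n-m)D ε_{iₘ}`,
  via the chain rule `∂_{iₘ}(b · f) = b_{iₘiₘ} (b · ∂_{iₘ} f)` for upper triangular `b`,
  `pderiv_linSubst_of_row_eq`);
* PROVES the degree bookkeeping used by BIP §6(a) (§4): torus weight vectors of `k[Sym^m]` are
  combinations of monomials of that weight (`monWeight_eq_of_mem_weightSpace`), hence "a weight
  pins the degree" (`isHomogeneous_of_mem_highestWeightSpace`, BLMW 2011 §4.4), and highest-weight
  vectors of degree one are multiples of the coordinate of `x_{iₘ}^m`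
  (`exists_eq_smul_X_of_mem_weightSpace`, `eq_single_of_smul_X_mem_highestWeightSpace`; BIP's
  "the case `d = 1` is trivial" in the proof of Prop. 2.4).

The surjectivity half of BIP's Prop. 5.6 (plethysm stability: every highest-weight vector with
`λ₂ ≤ m`, `λ₂ + |λ̄| ≤ md` is a lift) rests on the tableau bases of §4 and is NOT proved here; it is
vendored as a named fact next to Prop. 2.4 in `OccurrenceObstructionsBIP.lean`.

## References

* P. Bürgisser, C. Ikenmeyer, G. Panova, J. AMS 32 (2019) = arXiv:1604.06431v3, §3(a)
  (`∂_v^k`), §5(a)–(b): Lemma 5.1, Lemma 5.2, (5.3), Lemma 5.3, Thm. 5.4; §6(a) (key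
  `BurgisserIkenmeyerPanovaJAMS2019`).
* P. Bürgisser, J.M. Landsberg, L. Manivel, J. Weyman, SIAM J. Comput. 40 (2011), §4.4 (a weight
  pins the degree) (key `BurgisserEtAl2011`).
* W. Fulton, J. Harris, *Representation Theory*, GTM 129, §15.5 (key `FultonHarrisGTM129`).
-/

noncomputable section

open MvPolynomial

namespace Literature.Computability.AlgebraicComplexity

variable {k : Type*} [Field k] {σ : Type*}

/-! ### Iterated partial derivatives -/

/-- The `r`-fold partial derivative `∂_i^r` on `k[x_σ]`, as a `k`-linear map (the `r`-th power of
Mathlib's derivation `MvPolynomial.pderiv i`). BIP §3(a) ("We denote by `∂_v^k` the `k`-fold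
composition of `∂_v`"), used for `v = e_1` in §5(a). [cite: BurgisserIkenmeyerPanovaJAMS2019, §3(a)] -/
def iterPderiv (i : σ) (r : ℕ) : MvPolynomial σ k →ₗ[k] MvPolynomial σ k :=
  ((pderiv i : Derivation k (MvPolynomial σ k) (MvPolynomial σ k)) :
    MvPolynomial σ k →ₗ[k] MvPolynomial σ k) ^ r

/-- `∂_i^0 = id`. [folklore] -/
@[simp]
theorem iterPderiv_zero_apply (i : σ) (f : MvPolynomial σ k) : iterPderiv i 0 f = f := by
  rw [iterPderiv, pow_zero, Module.End.one_apply]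

/-- `∂_i^{r+1} = ∂_i ∘ ∂_i^r`. [folklore] -/
theorem iterPderiv_succ_apply (i : σ) (r : ℕ) (f : MvPolynomial σ k) :
    iterPderiv i (r + 1) f = pderiv i (iterPderiv i r f) := by
  rw [iterPderiv, pow_succ', Module.End.mul_apply]
  rfl

/-- **Iterated derivative of a monomial**: `∂_i^r (a x^s) = a · s_i (s_i - 1) ⋯ (s_i - r + 1) x^{s - r ε_i}`
(falling factorial; zero when `s_i < r`). BIP §5(a) (proof of Lemma 5.1:
`∂_{e_1}^{n-m} X^β = β_1 (β_1 - 1) ⋯ (β_1 - n + m + 1) X^{β - δ}`).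
[cite: BurgisserIkenmeyerPanovaJAMS2019, Lemma 5.1 (proof)] -/
theorem iterPderiv_monomial (i : σ) (r : ℕ) (s : σ →₀ ℕ) (a : k) :
    iterPderiv i r (monomial s a) =
      monomial (s - Finsupp.single i r) (a * ((s i).descFactorial r : ℕ)) := by
  classical
  induction r with
  | zero =>
    rw [iterPderiv_zero_apply, Finsupp.single_zero, tsub_zero, Nat.descFactorial_zero, Nat.cast_one,
      mul_one]
  | succ r ih =>
    rw [iterPderiv_succ_apply, ih, pderiv_monomial]
    have h1 : s - Finsupp.single i r - Finsupp.single i 1 = s - Finsupp.single i (r + 1) := by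
      ext j
      simp only [Finsupp.coe_tsub, Pi.sub_apply, Finsupp.single_apply]
      split_ifs <;> omega
    have h2 : a * ((s i).descFactorial r : ℕ) * ((s - Finsupp.single i r) i : ℕ) =
        a * ((s i).descFactorial (r + 1) : ℕ) := by
      rw [Finsupp.coe_tsub, Pi.sub_apply, Finsupp.single_eq_same, Nat.descFactorial_succ, mul_assoc,
        ← Nat.cast_mul, mul_comm ((s i).descFactorial r)]
    rw [h1, h2]

/-- `∂_i^r (x_i^r · a x^s) = a (s_i + r)!/(s_i)! · x^s`: on `x_i^r · Sym`, the iterated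
derivative is the diagonal map `Δ` of BIP Lemma 5.2 ("`∂^{n-m}/∂X_1^{n-m} (X_1^{n-m} p) =
∑_i (i+n-m)(i+n-m-1)⋯(i+1) a_i X_1^i`, hence `p ↦ ∂^{n-m}(X_1^{n-m} p)` is injective").
[cite: BurgisserIkenmeyerPanovaJAMS2019, Lemma 5.2] -/
theorem iterPderiv_X_pow_mul_monomial [DecidableEq σ] (i : σ) (r : ℕ) (s : σ →₀ ℕ) (a : k) :
    iterPderiv i r (X i ^ r * monomial s a) =
      monomial s (a * ((s i + r).descFactorial r : ℕ)) := by
  rw [X_pow_eq_monomial, monomial_mul, one_mul, iterPderiv_monomial]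
  have h1 : Finsupp.single i r + s - Finsupp.single i r = s := by
    ext j
    simp only [Finsupp.coe_tsub, Pi.sub_apply, Finsupp.coe_add, Pi.add_apply, Finsupp.single_apply]
    split_ifs <;> omega
  rw [h1, Finsupp.add_apply, Finsupp.single_eq_same, add_comm]

/-- The falling factorial `(e + r)!/e!` is a positive integer. [folklore] -/
theorem descFactorial_add_pos (e r : ℕ) : 0 < (e + r).descFactorial r :=
  Nat.pos_of_ne_zero fun h => by
    have := Nat.descFactorial_eq_zero_iff_lt.mp h
    omega

/-! ### Derivatives of linear substitution instances along a fixed direction -/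

/-- **Chain rule for a substitution fixing the direction `i`.** If row `i` of `B` is `B_{ii} e_i`
(i.e. `X_i` occurs only in the image of `X_i`, with coefficient `B_{ii}` — the case of the greatest
index for an upper triangular `B`), then `∂_i (B · f) = B_{ii} · (B · ∂_i f)`. This is the
`U_N`-equivariance of BIP's multiplication map `M` (§5(a): "`M` is `U_N`-equivariant, since `U_N`
acts on `Sym V` via algebra automorphisms and leaves `e_1` invariant") in dual form.
[cite: BurgisserIkenmeyerPanovaJAMS2019, §5(a)] -/
theorem pderiv_linSubst_of_row_eq [Fintype σ] [DecidableEq σ] (B : Matrix σ σ k) (i : σ)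
    (hB : ∀ j, j ≠ i → B i j = 0) (f : MvPolynomial σ k) :
    pderiv i (linSubst σ k B f) = B i i • linSubst σ k B (pderiv i f) := by
  induction f using MvPolynomial.induction_on with
  | C a => rw [linSubst_C, pderiv_C, map_zero, smul_zero]
  | add p q hp hq => rw [map_add, map_add, hp, hq, map_add, map_add, smul_add]
  | mul_X p j hp =>
    have hXj : pderiv i (linSubst σ k B (X j)) = C (B i j) := by
      rw [linSubst_X, map_sum]
      simp only [smul_eq_C_mul, Derivation.leibniz, pderiv_C, pderiv_X, smul_eq_mul]
      rw [Finset.sum_eq_single i]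
      · simp
      · intro l _ hl
        simp [hl]
      · exact fun h => absurd (Finset.mem_univ i) h
    rw [map_mul, pderiv_mul, hp, hXj, pderiv_mul, map_add, map_mul, map_mul, smul_add, pderiv_X]
    by_cases hji : j = i
    · subst hji
      simp only [Pi.single_eq_same, map_one, mul_one, smul_eq_C_mul]
      ring
    · rw [hB j hji, Pi.single_eq_of_ne hji, map_zero, map_zero]
      simp only [mul_zero, add_zero, smul_zero, smul_mul_assoc]

/-- Iterated form: `∂_i^r (B · f) = B_{ii}^r · (B · ∂_i^r f)` when row `i` of `B` is `B_{ii} e_i`.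
[cite: BurgisserIkenmeyerPanovaJAMS2019, §5(a)] -/
theorem iterPderiv_linSubst_of_row_eq [Fintype σ] [DecidableEq σ] (B : Matrix σ σ k) (i : σ)
    (hB : ∀ j, j ≠ i → B i j = 0) (r : ℕ) (f : MvPolynomial σ k) :
    iterPderiv i r (linSubst σ k B f) = B i i ^ r • linSubst σ k B (iterPderiv i r f) := by
  induction r with
  | zero => simp
  | succ r ih =>
    rw [iterPderiv_succ_apply, ih, Derivation.map_smul, pderiv_linSubst_of_row_eq B i hB, smul_smul,
      iterPderiv_succ_apply, pow_succ]

/-! ### The inner lifting (dual of BIP's `κ_{m,n}^d`) -/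

section InnerLift

variable [Fintype σ] [DecidableEq σ]

/-- **The inner degree lifting on polynomial functions.** For `m ≤ n` and a direction `i`, the
`k`-algebra homomorphism `k[Sym^m] → k[Sym^n]`, `F ↦ F ∘ ∂_i^{n-m}`: the coordinate `X_d` of
`Sym^m` goes to the linear form `q ↦ coeff_d (∂_i^{n-m} q)` on `Sym^n`. This is the dual
`(κ_{m,n}^d)^* = Sym^d M^*` of BIP's inner degree lifting (5.3)
`κ : Sym^d Sym^m V → Sym^d Sym^n V, p^d ↦ (p e_1^{n-m})^d` under the identification of
`Sym^d Sym^m V` with degree-`d` polynomial functions on `Sym^m V^*`, by Thm. 5.4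
(`⟨κ(f), q^d⟩ = ⟨f, M^*(q)^d⟩`) and Lemma 5.1 (`M^*(q) = (m!/n!) ∂_{e_1}^{n-m} q`); the
normalising factor `m!/n!` is dropped (it rescales degree-`d` functions by `(m!/n!)^d ≠ 0`).
[cite: BurgisserIkenmeyerPanovaJAMS2019, §5(b) (5.3) and Thm. 5.4] -/
def innerLift (i : σ) (m n : ℕ) :
    MvPolynomial (DegIdx σ m) k →ₐ[k] MvPolynomial (DegIdx σ n) k :=
  aeval fun d : DegIdx σ m =>
    ∑ e : DegIdx σ n, coeff d.1 (iterPderiv i (n - m) (monomial e.1 (1 : k))) • X e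

/-- `innerLift` on a coordinate. [cite: BurgisserIkenmeyerPanovaJAMS2019, §5(b) (5.3)] -/
theorem innerLift_X (i : σ) (m n : ℕ) (d : DegIdx σ m) :
    innerLift i m n (X d : MvPolynomial (DegIdx σ m) k) =
      ∑ e : DegIdx σ n, coeff d.1 (iterPderiv i (n - m) (monomial e.1 (1 : k))) • X e := by
  rw [innerLift, aeval_X]

/-- Expansion of a linear map on a form in the monomial basis: for `q` homogeneous of degree `n`,
`coeff_d (L q) = ∑_e coeff_e q · coeff_d (L x^e)`. [folklore] -/
theorem coeff_linearMap_eq_sum {n : ℕ} (L : MvPolynomial σ k →ₗ[k] MvPolynomial σ k)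
    {q : MvPolynomial σ k} (hq : q.IsHomogeneous n) (d : σ →₀ ℕ) :
    coeff d (L q) = ∑ e : DegIdx σ n, coeff e.1 q * coeff d (L (monomial e.1 (1 : k))) := by
  conv_lhs => rw [← sum_coeff_smul_monomial_eq hq]
  simp only [map_sum, map_smul, coeff_sum, coeff_smul, smul_eq_mul]

/-- **BIP Thm. 5.4 (evaluation of a lifted function), for the dual lifting.** For `q` homogeneous
of degree `n` and `m ≤ n`: `(innerLift F)(q) = F(∂_i^{n-m} q)` on coefficient vectors. BIP:
"`⟨κ_{m,n}^d(f), q^d⟩ = ⟨f, M^*(q)^d⟩` ... This allows to express the evaluation of the lifted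
`κ(f)` at `q`, viewed as a polynomial function on `Sym^n V^*`, as the evaluation of `f` at
`M^*(q)`." [cite: BurgisserIkenmeyerPanovaJAMS2019, Thm. 5.4] -/
theorem aeval_formCoeff_innerLift (i : σ) {m n : ℕ} {q : MvPolynomial σ k}
    (hq : q.IsHomogeneous n) (F : MvPolynomial (DegIdx σ m) k) :
    aeval (formCoeff n q) (innerLift i m n F) =
      aeval (formCoeff m (iterPderiv i (n - m) q)) F := by
  suffices h : (aeval (formCoeff n q)).comp (innerLift i m n) =
      aeval (formCoeff m (iterPderiv i (n - m) q)) from congrArg (fun φ => φ F) h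
  refine MvPolynomial.algHom_ext fun d => ?_
  rw [AlgHom.comp_apply, innerLift_X, map_sum, aeval_X, formCoeff_apply,
    coeff_linearMap_eq_sum _ hq]
  refine Finset.sum_congr rfl fun e _ => ?_
  rw [map_smul, aeval_X, formCoeff_apply, smul_eq_mul, mul_comm]

end InnerLift


/-! ### Pullback of polynomial functions along a linear map of forms -/

section Pullback

variable [Fintype σ] [DecidableEq σ]

/-- **Pullback along a linear map on forms.** For a `k`-linear map `T : k[x_σ] → k[x_σ]` and
degrees `a, b`, the `k`-algebra homomorphism `k[Sym^a] → k[Sym^b]` sending the coordinate `X_d`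
(`|d| = a`) to the linear form `q ↦ coeff_d (T q)` on `Sym^b`, i.e. `F ↦ F ∘ T` on coefficient
vectors (`aeval_formCoeff_pullbackAlong`). Both G20's `coordSubst m g` (`T = g⁻¹ ·`, `a = b = m`)
and the inner lifting `innerLift i m n` (`T = ∂_i^{n-m}`, `a = m`, `b = n`) are instances
(`coordSubst_eq_pullbackAlong`, `innerLift_eq_pullbackAlong`). Mulmuley–Sohoni 2001 §4
(comorphisms of equivariant maps); BIP §5(b). [folklore] -/
def pullbackAlong (a b : ℕ) (T : MvPolynomial σ k →ₗ[k] MvPolynomial σ k) :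
    MvPolynomial (DegIdx σ a) k →ₐ[k] MvPolynomial (DegIdx σ b) k :=
  aeval fun d : DegIdx σ a => ∑ e : DegIdx σ b, coeff d.1 (T (monomial e.1 (1 : k))) • X e

/-- `pullbackAlong` on a coordinate. [folklore] -/
theorem pullbackAlong_X (a b : ℕ) (T : MvPolynomial σ k →ₗ[k] MvPolynomial σ k) (d : DegIdx σ a) :
    pullbackAlong a b T (X d : MvPolynomial (DegIdx σ a) k) =
      ∑ e : DegIdx σ b, coeff d.1 (T (monomial e.1 (1 : k))) • X e := by
  rw [pullbackAlong, aeval_X]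

/-- G20's `coordSubst m g` is the pullback along `g⁻¹ ·` in degree `m`. [folklore] -/
theorem coordSubst_eq_pullbackAlong (m : ℕ) (g : GL σ k) :
    coordSubst m g = pullbackAlong m m (linSubstRep σ k g⁻¹) :=
  rfl

/-- The inner lifting is the pullback along `∂_i^{n-m}`. [folklore] -/
theorem innerLift_eq_pullbackAlong (i : σ) (m n : ℕ) :
    innerLift (k := k) i m n = pullbackAlong m n (iterPderiv i (n - m)) :=
  rfl

/-- **Evaluation of a pullback**: `(pullbackAlong a b T F)(q) = F(T q)` for `q` homogeneous of
degree `b`. [folklore] -/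
theorem aeval_formCoeff_pullbackAlong {a b : ℕ} (T : MvPolynomial σ k →ₗ[k] MvPolynomial σ k)
    {q : MvPolynomial σ k} (hq : q.IsHomogeneous b) (F : MvPolynomial (DegIdx σ a) k) :
    aeval (formCoeff b q) (pullbackAlong a b T F) = aeval (formCoeff a (T q)) F := by
  suffices h : (aeval (formCoeff b q)).comp (pullbackAlong a b T) = aeval (formCoeff a (T q)) from
    congrArg (fun φ => φ F) h
  refine MvPolynomial.algHom_ext fun d => ?_
  rw [AlgHom.comp_apply, pullbackAlong_X, map_sum, aeval_X, formCoeff_apply,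
    coeff_linearMap_eq_sum _ hq]
  refine Finset.sum_congr rfl fun e _ => ?_
  rw [map_smul, aeval_X, formCoeff_apply, smul_eq_mul, mul_comm]

/-- **Composition of pullbacks**: if `T` maps degree-`b` monomials to forms of degree `a`, then
`pullbackAlong b c T' ∘ pullbackAlong a b S = pullbackAlong a c (S ∘ T')`, i.e.
`(F ∘ S) ∘ T' = F ∘ (S ∘ T')`. [folklore] -/
theorem pullbackAlong_comp {a b c : ℕ} (S T : MvPolynomial σ k →ₗ[k] MvPolynomial σ k)
    (hT : ∀ e : DegIdx σ c, (T (monomial e.1 1)).IsHomogeneous b) :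
    (pullbackAlong b c T).comp (pullbackAlong a b S) = pullbackAlong a c (S ∘ₗ T) := by
  refine MvPolynomial.algHom_ext fun d => ?_
  rw [AlgHom.comp_apply, pullbackAlong_X, map_sum, pullbackAlong_X]
  simp only [map_smul, pullbackAlong_X, Finset.smul_sum, smul_smul]
  rw [Finset.sum_comm]
  refine Finset.sum_congr rfl fun e' _ => ?_
  rw [← Finset.sum_smul]
  congr 1
  rw [LinearMap.comp_apply, coeff_linearMap_eq_sum S (hT e')]
  refine Finset.sum_congr rfl fun e _ => ?_
  rw [mul_comm]

/-- An algebra homomorphism agreeing with another up to the scalar `c` on the variables agrees with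
it up to `c^D` on forms of degree `D`. [folklore] -/
theorem algHom_apply_eq_pow_smul_of_isHomogeneous {ι A : Type*} [CommSemiring A] [Algebra k A]
    (φ₁ φ₂ : MvPolynomial ι k →ₐ[k] A) (c : k) (h : ∀ d, φ₁ (X d) = c • φ₂ (X d))
    {F : MvPolynomial ι k} {D : ℕ} (hF : F.IsHomogeneous D) : φ₁ F = c ^ D • φ₂ F := by
  classical
  have h1 : ∀ (φ : MvPolynomial ι k →ₐ[k] A) (s : ι →₀ ℕ) (r : k),
      φ (monomial s r) = r • s.prod fun d e => φ (X d) ^ e := by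
    intro φ s r
    conv_lhs => rw [show φ = aeval (fun d => φ (X d)) from
      (MvPolynomial.aeval_unique φ)]
    rw [aeval_monomial, Algebra.smul_def]
  conv_lhs => rw [← F.support_sum_monomial_coeff]
  conv_rhs => rw [← F.support_sum_monomial_coeff]
  rw [map_sum, map_sum, Finset.smul_sum]
  refine Finset.sum_congr rfl fun s hs => ?_
  rw [h1 φ₁, h1 φ₂, smul_comm]
  congr 1
  have hdeg : (s.sum fun _ e => e) = D := by
    have := hF (mem_support_iff.mp hs)
    simpa [Finsupp.weight_apply] using this
  rw [← hdeg, Finsupp.prod, Finsupp.prod, Finsupp.sum, ← Finset.prod_pow_eq_pow_sum,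
    ← Finset.prod_smul]
  refine Finset.prod_congr rfl fun d _ => ?_
  rw [h, smul_pow]

/-- Pulling back along `c • T` multiplies forms of degree `D` by `c^D`. [folklore] -/
theorem pullbackAlong_smul {a b : ℕ} (c : k) (T : MvPolynomial σ k →ₗ[k] MvPolynomial σ k)
    {F : MvPolynomial (DegIdx σ a) k} {D : ℕ} (hF : F.IsHomogeneous D) :
    pullbackAlong a b (c • T) F = c ^ D • pullbackAlong a b T F := by
  refine algHom_apply_eq_pow_smul_of_isHomogeneous _ _ c (fun d => ?_) hF
  rw [pullbackAlong_X, pullbackAlong_X, Finset.smul_sum]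
  refine Finset.sum_congr rfl fun e _ => ?_
  rw [LinearMap.smul_apply, coeff_smul, smul_eq_mul, smul_smul]

end Pullback

/-! ### The inner lifting maps highest-weight vectors to highest-weight vectors (BIP Lemma 5.3) -/

section InnerLiftHW

variable [Fintype σ] [LinearOrder σ]

omit [Fintype σ] [LinearOrder σ] in
/-- Iterated derivatives of forms of degree `n` are forms of degree `n - r` (Mathlib's
`IsHomogeneous.pderiv`, iterated). [folklore] -/
theorem IsHomogeneous.iterPderiv (i : σ) {n : ℕ} {f : MvPolynomial σ k} (hf : f.IsHomogeneous n) :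
    ∀ r : ℕ, (iterPderiv i r f).IsHomogeneous (n - r)
  | 0 => by simpa using hf
  | r + 1 => by
    rw [iterPderiv_succ_apply]
    have h := (IsHomogeneous.iterPderiv i hf r).pderiv (i := i)
    rwa [Nat.sub_sub] at h

/-- **BIP Lemma 5.3, dual form: the inner lifting intertwines the `GL`-actions up to a
character.** For `b` upper triangular, `iₘ` the greatest index, `m ≤ n` and `F` a form of degree
`D` on `k[Sym^m]`: `b · innerLift(F) = (b_{iₘiₘ})^{-(n-m)D} · innerLift(b · F)` (row `iₘ` of
`b⁻¹` is `(b⁻¹)_{iₘiₘ} e_{iₘ}`, so `∂_{iₘ}^{n-m} (b⁻¹ · q) = (b⁻¹)_{iₘiₘ}^{n-m} b⁻¹ · ∂^{n-m} q`).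
BIP: "The `U_N`-equivariance of `M` immediately extends to its `d`-fold symmetric product
`κ_{m,n}^d` ... it suffices to check that `κ` raises the weight of weight vectors by
`(d(n-m), 0, …, 0)`." [cite: BurgisserIkenmeyerPanovaJAMS2019, Lemma 5.3] -/
theorem coordSubst_innerLift (iₘ : σ) (hiₘ : ∀ j, j ≤ iₘ) {m n : ℕ} (hmn : m ≤ n) {b : GL σ k}
    (hb : Literature.NumberTheory.DiophantineGeometry.IsUpperTriangular b) {F : MvPolynomial (DegIdx σ m) k} {D : ℕ} (hF : F.IsHomogeneous D) :
    coordSubst n b (innerLift iₘ m n F) =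
      (((b⁻¹ : GL σ k) : Matrix σ σ k) iₘ iₘ ^ (n - m)) ^ D • innerLift iₘ m n (coordSubst m b F) := by
  have hrow : ∀ j, j ≠ iₘ → ((b⁻¹ : GL σ k) : Matrix σ σ k) iₘ j = 0 := fun j hj =>
    ((Literature.NumberTheory.DiophantineGeometry.borelSubgroup σ k).inv_mem hb).apply_eq_zero ((hiₘ j).lt_of_ne hj)
  -- both sides as pullbacks
  have h1 : coordSubst n b (innerLift iₘ m n F) =
      pullbackAlong m n (iterPderiv iₘ (n - m) ∘ₗ linSubstRep σ k b⁻¹) F := by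
    rw [coordSubst_eq_pullbackAlong, innerLift_eq_pullbackAlong, ← AlgHom.comp_apply,
      pullbackAlong_comp]
    intro e
    exact linSubst_isHomogeneous _ (isHomogeneous_monomial _ (mem_degMonomials_iff.mp e.2))
  have h2 : innerLift iₘ m n (coordSubst m b F) =
      pullbackAlong m n (linSubstRep σ k b⁻¹ ∘ₗ iterPderiv iₘ (n - m)) F := by
    rw [coordSubst_eq_pullbackAlong, innerLift_eq_pullbackAlong, ← AlgHom.comp_apply,
      pullbackAlong_comp]
    intro e
    have := IsHomogeneous.iterPderiv iₘ
      (isHomogeneous_monomial (R := k) (1 : k) (mem_degMonomials_iff.mp e.2)) (n - m)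
    rwa [Nat.sub_sub_self hmn] at this
  have hT : iterPderiv iₘ (n - m) ∘ₗ linSubstRep σ k b⁻¹ =
      (((b⁻¹ : GL σ k) : Matrix σ σ k) iₘ iₘ ^ (n - m)) • (linSubstRep σ k b⁻¹ ∘ₗ iterPderiv iₘ (n - m)) := by
    refine LinearMap.ext fun f => ?_
    rw [LinearMap.comp_apply, LinearMap.smul_apply, LinearMap.comp_apply, linSubstRep_apply,
      linSubstRep_apply]
    exact iterPderiv_linSubst_of_row_eq _ iₘ hrow (n - m) f
  rw [h1, h2, hT, pullbackAlong_smul _ _ hF]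

/-- **The inner lifting maps highest-weight vectors to highest-weight vectors** (BIP Lemma 5.3 in
the coordinate-ring convention): if `F ∈ k[Sym^m]` is a form of degree `D` and a highest-weight
vector of weight `χ`, then `innerLift iₘ m n F` (`iₘ` the greatest index, `m ≤ n`) is a
highest-weight vector of weight `χ - (n-m)D ε_{iₘ}` (BIP: `κ` "raises the weight by
`(d(n-m), 0, …, 0)`"; the sign and the position `iₘ` reflect the dual convention
`(g · F)(v) = F(g⁻¹ v)` of `coordRep`, in which occurring weights are duals of partitions and the
first row sits at the greatest index). [cite: BurgisserIkenmeyerPanovaJAMS2019, Lemma 5.3] -/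
theorem innerLift_mem_highestWeightSpace (iₘ : σ) (hiₘ : ∀ j, j ≤ iₘ) {m n : ℕ} (hmn : m ≤ n)
    {χ : Literature.NumberTheory.DiophantineGeometry.Weight σ} {F : MvPolynomial (DegIdx σ m) k} {D : ℕ} (hF : F.IsHomogeneous D)
    (hχ : F ∈ Literature.NumberTheory.DiophantineGeometry.highestWeightSpace (coordRep σ k m) χ) :
    innerLift iₘ m n F ∈ Literature.NumberTheory.DiophantineGeometry.highestWeightSpace (coordRep σ k n)
      (χ + Pi.single iₘ (-(((n - m) * D : ℕ) : ℤ))) := by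
  intro b hb
  have hinv : ((b⁻¹ : GL σ k) : Matrix σ σ k) iₘ iₘ = ((b : Matrix σ σ k) iₘ iₘ)⁻¹ := by
    have hb' : Literature.NumberTheory.DiophantineGeometry.IsUpperTriangular b⁻¹ := (Literature.NumberTheory.DiophantineGeometry.borelSubgroup σ k).inv_mem hb
    have h := Literature.NumberTheory.DiophantineGeometry.diag_mul_of_isUpperTriangular hb hb' iₘ
    rw [mul_inv_cancel, Units.val_one, Matrix.one_apply_eq] at h
    exact eq_inv_of_mul_eq_one_right h.symm
  rw [coordRep_apply, coordSubst_innerLift iₘ hiₘ hmn hb hF, ← coordRep_apply, hχ b hb, map_smul,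
    smul_smul, Literature.NumberTheory.DiophantineGeometry.weightChar_add _ _ hb, Literature.NumberTheory.DiophantineGeometry.weightChar_single, hinv, ← pow_mul, zpow_neg, zpow_natCast,
    inv_pow, mul_comm]

end InnerLiftHW


/-! ### BIP Lemma 5.2: `∂^{n-m} ∘ (X^{n-m} ·)` is a diagonal automorphism `Δ` of `Sym^m V^*` -/

section Delta

variable [Fintype σ] [DecidableEq σ]

/-- **BIP Lemma 5.2 in coordinates.** For `p` homogeneous of degree `m`, the degree-`m`
coefficients of `∂_i^r (X_i^r · p)` are those of `p` scaled by the positive integers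
`(e_i + r)!/e_i!`: `Δ := M^* ∘ (X_1^{n-m} ·)` is the diagonal automorphism
`X^e ↦ (e_1+1)(e_1+2)⋯(e_1+n-m) X^e` of `Sym^m V^*` (up to BIP's normalisation `m!/n!`).
[cite: BurgisserIkenmeyerPanovaJAMS2019, Lemma 5.2] -/
theorem formCoeff_iterPderiv_X_pow_mul (i : σ) (r : ℕ) {m : ℕ} {p : MvPolynomial σ k}
    (hp : p.IsHomogeneous m) (e : DegIdx σ m) :
    formCoeff m (iterPderiv i r (X i ^ r * p)) e =
      ((e.1 i + r).descFactorial r : ℕ) * formCoeff m p e := by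
  rw [formCoeff_apply, formCoeff_apply,
    show iterPderiv i r (X i ^ r * p) = (iterPderiv i r ∘ₗ LinearMap.mulLeft k (X i ^ r)) p from rfl,
    coeff_linearMap_eq_sum _ hp]
  simp only [LinearMap.comp_apply, LinearMap.mulLeft_apply, iterPderiv_X_pow_mul_monomial, one_mul,
    coeff_monomial]
  rw [Finset.sum_eq_single e]
  · rw [if_pos rfl, mul_comm]
  · intro e' _ hne
    rw [if_neg (fun h => hne (Subtype.ext h)), mul_zero]
  · exact fun h => absurd (Finset.mem_univ e) h

/-- The diagonal change of coordinates `F ↦ F ∘ Δ` on polynomial functions on `Sym^m V^*`: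
scaling the coordinate `X_e` by `(e_i + r)!/e_i!`. Evaluating the scaled function at `p` is
evaluating `F` at `∂_i^r (X_i^r p)` (BIP, proof of Prop. 2.4: "apply Proposition 3.2 to the
composition `p ↦ ⟨f, Δ(p)^d⟩`"). [cite: BurgisserIkenmeyerPanovaJAMS2019, Lemma 5.2] -/
theorem aeval_formCoeff_iterPderiv_X_pow_mul (i : σ) (r : ℕ) {m : ℕ} {p : MvPolynomial σ k}
    (hp : p.IsHomogeneous m) (F : MvPolynomial (DegIdx σ m) k) :
    aeval (formCoeff m (iterPderiv i r (X i ^ r * p))) F =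
      aeval (formCoeff m p)
        (aeval (fun e : DegIdx σ m => C (((e.1 i + r).descFactorial r : ℕ) : k) * X e) F) := by
  rw [← AlgHom.comp_apply, comp_aeval]
  have hfun : (fun e : DegIdx σ m => aeval (formCoeff m p)
      (C (((e.1 i + r).descFactorial r : ℕ) : k) * X e)) =
      formCoeff m (iterPderiv i r (X i ^ r * p)) := by
    funext e
    rw [map_mul, aeval_C, aeval_X, Algebra.algebraMap_self_apply, formCoeff_iterPderiv_X_pow_mul i r hp e]
  rw [hfun]

/-- Scaling the variables by nonzero constants is injective on polynomials: it multiplies the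
coefficient of `X^s` by `∏_e c_e^{s_e} ≠ 0`. [folklore] -/
theorem aeval_C_mul_X_monomial {ι : Type*} (c : ι → k) (s : ι →₀ ℕ) (a : k) :
    aeval (fun e : ι => C (c e) * X e) (monomial s a) =
      monomial s (a * s.prod fun e n => c e ^ n) := by
  rw [aeval_monomial, algebraMap_eq, monomial_eq, Finsupp.prod, Finsupp.prod, Finsupp.prod, map_mul,
    map_prod]
  simp only [mul_pow, Finset.prod_mul_distrib, map_pow]
  ring

/-- The support (hence the total degree and nonvanishing) of a polynomial is unchanged by scaling
the variables by nonzero constants. [folklore] -/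
theorem support_aeval_C_mul_X {ι : Type*} (c : ι → k) (hc : ∀ e, c e ≠ 0) (F : MvPolynomial ι k) :
    (aeval (fun e : ι => C (c e) * X e) F).support = F.support := by
  classical
  have hexp : aeval (fun e : ι => C (c e) * X e) F =
      ∑ s ∈ F.support, monomial s (coeff s F * s.prod fun e n => c e ^ n) := by
    conv_lhs => rw [← F.support_sum_monomial_coeff, map_sum]
    exact Finset.sum_congr rfl fun s _ => aeval_C_mul_X_monomial c s _
  ext s
  rw [hexp, mem_support_iff, mem_support_iff, coeff_sum]
  simp only [coeff_monomial]
  rw [Finset.sum_ite_eq']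
  have hprod : (s.prod fun e n => c e ^ n) ≠ 0 :=
    Finsupp.prod_ne_zero_iff.mpr fun e _ => pow_ne_zero _ (hc e)
  by_cases h : coeff s F = 0
  · simp [h]
  · simp [h, mem_support_iff, hprod]

end Delta


/-! ### Torus weight vectors of `k[Sym^m]`: monomials of that weight; a weight pins the degree -/

section WeightPinsDegree

variable [Fintype σ] [LinearOrder σ]

/-- Coefficients of the torus action: a diagonal `t` multiplies the coefficient of `X^s` by the
character `weightChar (monWeight s) t`. [folklore] -/
theorem coeff_coordSubst_of_isDiagonalGL {m : ℕ} {t : GL σ k} (ht : Literature.NumberTheory.DiophantineGeometry.IsDiagonalGL t)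
    (F : MvPolynomial (DegIdx σ m) k) (s : DegIdx σ m →₀ ℕ) :
    coeff s (coordSubst m t F) = Literature.NumberTheory.DiophantineGeometry.weightChar (monWeight s) t * coeff s F := by
  classical
  conv_lhs => rw [← F.support_sum_monomial_coeff, map_sum]
  simp only [coordSubst_monomial_of_isDiagonalGL ht, coeff_sum, coeff_smul, coeff_monomial,
    smul_eq_mul, mul_ite, mul_zero]
  rw [Finset.sum_ite_eq']
  split_ifs with h
  · rfl
  · rw [notMem_support_iff.mp h, mul_zero]

/-- **Torus weight vectors are combinations of monomials of that weight.** Over an infinite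
field, if `F ∈ k[Sym^m]` is a weight vector of weight `χ` for the diagonal torus, every monomial
in its support has torus weight `χ` (linear independence of characters,
`eq_zero_of_sum_mul_weightChar_eq_zero`). Fulton–Harris §15.5 (weight space decomposition of
`Sym(Sym V)`). [folklore] -/
theorem monWeight_eq_of_mem_weightSpace [Infinite k] {m : ℕ} {χ : Literature.NumberTheory.DiophantineGeometry.Weight σ}
    {F : MvPolynomial (DegIdx σ m) k} (hF : F ∈ Literature.NumberTheory.DiophantineGeometry.weightSpace (coordRep σ k m) χ)
    {s : DegIdx σ m →₀ ℕ} (hs : s ∈ F.support) : monWeight s = χ := by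
  classical
  by_contra hne
  have key := eq_zero_of_sum_mul_weightChar_eq_zero (k := k) {monWeight s, χ}
    (fun v => if v = monWeight s then coeff s F else -coeff s F) (fun t ht => by
      rw [Finset.sum_pair hne, if_pos rfl, if_neg (Ne.symm hne)]
      have h := congrArg (coeff s) (hF t ht)
      rw [coordRep_apply, coeff_coordSubst_of_isDiagonalGL ht, coeff_smul, smul_eq_mul] at h
      linear_combination h)
    (monWeight s) (Finset.mem_insert_self _ _)
  rw [if_pos rfl] at key
  exact (mem_support_iff.mp hs) key

/-- **A weight pins the degree** (BLMW 2011 §4.4): a torus weight vector of `k[Sym^m]` of weight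
`χ` with `|χ| = -m D` (`m ≠ 0`) is a form of degree `D`. [cite: BurgisserEtAl2011, §4.4] -/
theorem isHomogeneous_of_mem_weightSpace [Infinite k] {m : ℕ} (hm : m ≠ 0) {χ : Literature.NumberTheory.DiophantineGeometry.Weight σ}
    {F : MvPolynomial (DegIdx σ m) k} (hF : F ∈ Literature.NumberTheory.DiophantineGeometry.weightSpace (coordRep σ k m) χ) {D : ℕ}
    (hD : χ.size = -((m * D : ℕ) : ℤ)) : F.IsHomogeneous D := by
  classical
  intro s hs
  have hw := monWeight_eq_of_mem_weightSpace hF (mem_support_iff.mpr hs)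
  have hsize := size_monWeight s
  rw [hw, hD, neg_inj, Nat.cast_inj] at hsize
  have hdeg : s.degree = D := (Nat.eq_of_mul_eq_mul_left (Nat.pos_of_ne_zero hm) hsize).symm
  rw [Finsupp.degree_eq_weight_one] at hdeg
  exact hdeg

/-- The same for highest-weight vectors (`T ⊆ B`). [cite: BurgisserEtAl2011, §4.4] -/
theorem isHomogeneous_of_mem_highestWeightSpace [Infinite k] {m : ℕ} (hm : m ≠ 0) {χ : Literature.NumberTheory.DiophantineGeometry.Weight σ}
    {F : MvPolynomial (DegIdx σ m) k} (hF : F ∈ Literature.NumberTheory.DiophantineGeometry.highestWeightSpace (coordRep σ k m) χ) {D : ℕ}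
    (hD : χ.size = -((m * D : ℕ) : ℤ)) : F.IsHomogeneous D :=
  isHomogeneous_of_mem_weightSpace hm (Literature.NumberTheory.DiophantineGeometry.highestWeightSpace_le_weightSpace _ _ hF) hD

/-! ### Highest-weight vectors of degree one are multiples of the coordinate of `x_{iₘ}^m` -/

/-- A torus weight vector of `k[Sym^m]` of degree one is a multiple of a single coordinate `X_e`
(distinct coordinates have distinct torus weights). [folklore] -/
theorem exists_eq_smul_X_of_mem_weightSpace [Infinite k] {m : ℕ} {χ : Literature.NumberTheory.DiophantineGeometry.Weight σ}
    {F : MvPolynomial (DegIdx σ m) k} (hF : F ∈ Literature.NumberTheory.DiophantineGeometry.weightSpace (coordRep σ k m) χ)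
    (h1 : F.IsHomogeneous 1) (hF0 : F ≠ 0) : ∃ (e : DegIdx σ m) (c : k), c ≠ 0 ∧ F = c • X e := by
  classical
  obtain ⟨s₀, hs₀⟩ := support_nonempty.mpr hF0
  -- every monomial of `F` is a coordinate `X_e`, and all have the same weight, hence coincide
  have hdeg : ∀ s ∈ F.support, ∃ e : DegIdx σ m, s = Finsupp.single e 1 := by
    intro s hs
    have h := h1 (mem_support_iff.mp hs)
    have h' : s.degree = 1 := by rw [Finsupp.degree_eq_weight_one]; exact h
    rw [Finsupp.degree] at h'
    obtain ⟨e, he⟩ := (Finsupp.sum_eq_one_iff s).mp h'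
    exact ⟨e, he⟩
  obtain ⟨e₀, rfl⟩ := hdeg s₀ hs₀
  have hsupp : ∀ s ∈ F.support, s = Finsupp.single e₀ 1 := by
    intro s hs
    obtain ⟨e, rfl⟩ := hdeg s hs
    have hw : monWeight (Finsupp.single e 1) = monWeight (Finsupp.single e₀ 1) := by
      rw [monWeight_eq_of_mem_weightSpace hF hs, monWeight_eq_of_mem_weightSpace hF hs₀]
    congr 1
    apply Subtype.ext
    ext i
    have hi := congrFun hw i
    rw [monWeight_apply, monWeight_apply, neg_inj, Nat.cast_inj,
      Finsupp.support_single _ one_ne_zero, Finsupp.support_single _ one_ne_zero,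
      Finset.sum_singleton, Finset.sum_singleton, Finsupp.single_eq_same, Finsupp.single_eq_same,
      one_mul, one_mul] at hi
    exact hi
  refine ⟨e₀, coeff (Finsupp.single e₀ 1) F, mem_support_iff.mp hs₀, ?_⟩
  conv_lhs => rw [← F.support_sum_monomial_coeff]
  rw [Finset.sum_eq_single_of_mem _ hs₀ fun s hs hne => absurd (hsupp s hs) hne, X,
    smul_monomial, smul_eq_mul, mul_one]

/-- The unipotent upper triangular element `u⁻¹ = 1 + ∑_{l ≠ iₘ} E_{l iₘ}` sends `x_{iₘ}` to the
all-ones linear form `∑_l x_l` (and fixes the other variables); `iₘ` the greatest index.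
[folklore] -/
theorem exists_borel_linSubst_inv_X_pow (iₘ : σ) (hiₘ : ∀ j, j ≤ iₘ) (m : ℕ) :
    ∃ b : GL σ k, Literature.NumberTheory.DiophantineGeometry.IsUpperTriangular b ∧
      linSubstRep σ k b⁻¹ (X iₘ ^ m) = (∑ x, C (1 : k) * X x) ^ m := by
  classical
  set N : Matrix σ σ k := Matrix.of fun x y => if y = iₘ ∧ x ≠ iₘ then 1 else 0 with hN
  have hN2 : N * N = 0 := by
    ext x z
    rw [Matrix.mul_apply, Matrix.zero_apply]
    refine Finset.sum_eq_zero fun y _ => ?_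
    by_cases hy : y = iₘ
    · have : N y z = 0 := by rw [hN, Matrix.of_apply, if_neg (fun h => h.2 hy)]
      rw [this, mul_zero]
    · have : N x y = 0 := by rw [hN, Matrix.of_apply, if_neg (fun h => hy h.1)]
      rw [this, zero_mul]
  refine ⟨⟨1 - N, 1 + N,
    by rw [sub_mul, mul_add, mul_add, one_mul, one_mul, mul_one, hN2]; abel,
    by rw [add_mul, mul_sub, mul_sub, one_mul, one_mul, mul_one, hN2]; abel⟩, ?_, ?_⟩
  · intro x y hyx
    change (1 - N) x y = 0
    change y < x at hyx
    rw [Matrix.sub_apply, Matrix.one_apply_ne (Ne.symm hyx.ne), hN, Matrix.of_apply, if_neg, sub_zero]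
    rintro ⟨rfl, -⟩
    exact (hiₘ x).not_gt hyx
  · rw [linSubstRep_apply, map_pow]
    congr 1
    change linSubst σ k (1 + N) (X iₘ) = _
    rw [linSubst_X]
    refine Finset.sum_congr rfl fun x _ => ?_
    rw [Matrix.add_apply, Matrix.one_apply, hN, Matrix.of_apply, smul_eq_C_mul]
    congr 2
    by_cases hx : x = iₘ
    · subst hx; simp
    · simp [hx]

/-- **Highest-weight vectors of degree one.** In characteristic zero, a highest-weight vector of
`k[Sym^m]` that is a multiple `c X_e` (`c ≠ 0`) of a coordinate is a multiple of the coordinate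
of `x_{iₘ}^m` (`iₘ` the greatest index): testing the `B`-semi-invariance against the unipotent
`u` with `u⁻¹ x_{iₘ} = ∑_l x_l`, the `X_{x_{iₘ}^m}`-component of `u · X_e` is the multinomial
coefficient of `e`, which is nonzero. (BIP, proof of Prop. 2.4: "The case `d = 1` is trivial": the
only highest weight of `Sym^1 Sym^n V = Sym^n V` is `(n)`.) [cite: BurgisserIkenmeyerPanovaJAMS2019, §6(a)] -/
theorem eq_single_of_smul_X_mem_highestWeightSpace [CharZero k] (iₘ : σ) (hiₘ : ∀ j, j ≤ iₘ)
    {m : ℕ} {χ : Literature.NumberTheory.DiophantineGeometry.Weight σ} {e : DegIdx σ m} {c : k} (hc : c ≠ 0)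
    (h : c • (X e : MvPolynomial (DegIdx σ m) k) ∈ Literature.NumberTheory.DiophantineGeometry.highestWeightSpace (coordRep σ k m) χ) :
    e.1 = Finsupp.single iₘ m := by
  classical
  by_contra hne
  obtain ⟨b, hb, hbX⟩ := exists_borel_linSubst_inv_X_pow (k := k) iₘ hiₘ m
  set e' : DegIdx σ m := ⟨Finsupp.single iₘ m, mem_degMonomials_iff.mpr (Finsupp.degree_single _ _)⟩
    with he'
  have hne' : e ≠ e' := fun h => hne (by rw [h])
  -- compare the `X_{e'}`-coefficients of `b · (c X_e) = χ(b) c X_e`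
  have key := congrArg (coeff (Finsupp.single e' 1)) (h b hb)
  simp only [coordRep_apply, map_smul, coordSubst_X, coeff_smul, coeff_sum, coeff_X, smul_eq_mul,
    mul_ite, mul_one, mul_zero, Finsupp.single_left_inj one_ne_zero, Finset.sum_ite_eq',
    Finset.mem_univ, if_true, if_neg hne'] at key
  -- `key : c * coeff_e (b⁻¹ · x_{iₘ}^m) = 0`, but that coefficient is a multinomial coefficient
  rw [mul_eq_zero] at key
  rcases key with hc0 | hcoeff
  · exact hc hc0
  · rw [show (monomial e'.1 (1 : k) : MvPolynomial σ k) = X iₘ ^ m by rw [he', X_pow_eq_monomial],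
      hbX, coeff_linearFormPow, if_pos (mem_degMonomials_iff.mp e.2)] at hcoeff
    simp only [one_pow, Finset.prod_const_one, mul_one, Nat.cast_eq_zero] at hcoeff
    exact (Nat.multinomial_pos _ _).ne' hcoeff

end WeightPinsDegree

end Literature.Computability.AlgebraicComplexity
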